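import Mathlib
import HarnessLib
import Summits.Ventures.LatticeQCDFlow.Scaling.AbelianHolonomyNonDetermination

/-!
# LatticeQCDFlow / Scaling — non-determination is not an abelian artefact: for ANY gauge group with
# elements of unbounded order, fewer than `(d−1)(L^d − 1)` plaquette holonomies never determine the rest

HONEST FRAMING: exact (Metropolis-corrected) sampling algorithms for lattice gauge theory;
figures of merit are autocorrelation/cost numbers at stated couplings and volumes; no
continuum-physics claim.

Venture `LatticeQCDFlow` (cell pub-lqcd), topic `Scaling`, FANOUT row 30 (lean-1, GEN-27) — OUR WORK on
THEORY-2.md §4 row C5 (gen25 Q2, converse, general gauge group).  `AbelianHolonomyNonDetermination` built,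
for any `B` with `#B < (d−1)(L^d − 1)`, an INTEGER CERTIFICATE `θ : links → ℤ` (`Σ_e θ_e σ∂p(e) = 0` on `B`,
`≠ 0` at some `p'`) and the commutative-group configuration `g^θ`.  The configuration `U(e) = g^{θ_e}` makes
sense in EVERY group `G` — its values are powers of one element and commute — so the same certificate refutes
determination for every `G` having, for each `n ≠ 0`, an element with `g^n ≠ 1` (every compact connected Lie
group of positive dimension, e.g. `SU(N)`, `U(N)`; `U(1)` and `ℤ` are the instances typed in the abelian file):

* **`sum_mul_signedBoundary_eq`** — `Σ_e θ_e·σ∂p(e) = θ(x,i) + θ(x+e_i,j) − θ(x+e_j,i) − θ(x,j)`;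
* **`plaquetteHolonomy_zpow_config_group`** — in ANY group, the configuration `e ↦ g^{θ_e}` has holonomy
  `g^{Σ_e θ_e σ∂p(e)}` around `p`;
* **`exists_plaquetteHolonomy_not_determined_group`** — NON-DETERMINATION FOR EVERY SUCH `G`: for any `B` with
  `#B < (d−1)(L^d − 1)` there are `p' ∉ B` and two `G`-configurations with the same holonomy around every
  `p ∈ B` and different holonomies around `p'`;
* **`covered_determine_imp_card_eq_group`** — hence a RANKED structure whose covered holonomies determine all
  plaquette holonomies of such a `G`-field is full (`#B = (d−1)(L^d − 1)`, i.e. optimal).  (The converse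
  direction, determination along a full structure, is the abelian phenomenon of `AbelianHolonomyDetermination`
  and is NOT claimed for non-abelian `G`.)

No `def`, no `sorry`, nothing cited as a fact beyond the tree.
-/

namespace Summit.Ventures.LatticeQCDFlow.Theory2.Autoregressive

open Finset
open Literature.MathematicalPhysics.QuantumFieldTheory

variable {d L : ℕ} [NeZero L]

/-- **`Σ_e θ_e·σ∂p(e) = θ(x,i) + θ(x+e_i,j) − θ(x+e_j,i) − θ(x,j)`** (no distinctness of the links needed).
[ours] -/
theorem sum_mul_signedBoundary_eq (θ : Edge d L → ℤ) (p : Plaquette d L) :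
    ∑ e, θ e * (Pi.single (p.1, p.2.1.1) 1 + Pi.single (p.1.shift p.2.1.1, p.2.1.2) 1 -
        Pi.single (p.1.shift p.2.1.2, p.2.1.1) 1 - Pi.single (p.1, p.2.1.2) 1 : Edge d L → ℤ) e =
      θ (p.1, p.2.1.1) + θ (p.1.shift p.2.1.1, p.2.1.2) - θ (p.1.shift p.2.1.2, p.2.1.1) - θ (p.1, p.2.1.2) := by
  classical
  have hs : ∀ a : Edge d L, ∑ e, θ e * (Pi.single a (1 : ℤ) : Edge d L → ℤ) e = θ a := fun a => by
    rw [Finset.sum_eq_single a]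
    · simp
    · intro e _ he; simp [Pi.single_eq_of_ne he]
    · intro h; exact absurd (Finset.mem_univ a) h
  simp only [Pi.add_apply, Pi.sub_apply, mul_add, mul_sub, Finset.sum_add_distrib, Finset.sum_sub_distrib, hs]

/-- **In ANY group, the configuration `e ↦ g^{θ_e}` has holonomy `g^{Σ_e θ_e σ∂p(e)}` around `p`** (powers of
one element commute). [ours] -/
theorem plaquetteHolonomy_zpow_config_group {G : Type*} [Group G] (g : G) (θ : Edge d L → ℤ)
    (p : Plaquette d L) :
    plaquetteHolonomy (fun e => g ^ θ e) p.1 p.2.1.1 p.2.1.2 =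
      g ^ (∑ e, θ e * (Pi.single (p.1, p.2.1.1) 1 + Pi.single (p.1.shift p.2.1.1, p.2.1.2) 1 -
        Pi.single (p.1.shift p.2.1.2, p.2.1.1) 1 - Pi.single (p.1, p.2.1.2) 1 : Edge d L → ℤ) e) := by
  rw [sum_mul_signedBoundary_eq, plaquetteHolonomy]
  simp only [← zpow_neg, ← zpow_add]
  congr 1

/-- **NON-DETERMINATION FOR EVERY GAUGE GROUP WITH ELEMENTS OF UNBOUNDED ORDER.**  `L ≥ 2`; `B` any collection
of plaquettes of `(ℤ/L)^d` with `#B < (d−1)(L^d − 1)`; `G` ANY group having, for each `n ≠ 0`, an element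
`g` with `g^n ≠ 1`.  Then some plaquette `p' ∉ B` is not determined by `B`: the configurations `g^θ` (for the
integer certificate `θ` of `AbelianHolonomyNonDetermination.exists_int_certificate`) and the trivial one agree
around every `p ∈ B` and differ around `p'`. [ours] -/
theorem exists_plaquetteHolonomy_not_determined_group (hL : 2 ≤ L) (B : Finset (Plaquette d L))
    (hlt : B.card < (d - 1) * (L ^ d - 1)) {G : Type*} [Group G]
    (hG : ∀ n : ℤ, n ≠ 0 → ∃ g : G, g ^ n ≠ 1) :
    ∃ p' : Plaquette d L, p' ∉ B ∧ ∃ U V : GaugeConfig d L G,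
      (∀ p ∈ B, plaquetteHolonomy U p.1 p.2.1.1 p.2.1.2 = plaquetteHolonomy V p.1 p.2.1.1 p.2.1.2) ∧
      plaquetteHolonomy U p'.1 p'.2.1.1 p'.2.1.2 ≠ plaquetteHolonomy V p'.1 p'.2.1.1 p'.2.1.2 := by
  obtain ⟨p', θ, hB, hp'⟩ := exists_int_certificate hL B hlt
  obtain ⟨g, hg⟩ := hG _ hp'
  have hone : ∀ q : Plaquette d L, plaquetteHolonomy (fun _ : Edge d L => (1 : G)) q.1 q.2.1.1 q.2.1.2 = 1 :=
    fun q => by simp [plaquetteHolonomy]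
  refine ⟨p', fun hmem => hp' (hB p' hmem), fun e => g ^ θ e, fun _ => 1, fun p hp => ?_, ?_⟩
  · rw [plaquetteHolonomy_zpow_config_group, hB p hp, zpow_zero, hone]
  · rw [plaquetteHolonomy_zpow_config_group, hone]
    exact hg

/-- **Hence, for such `G`, a ranked structure whose covered holonomies determine every plaquette holonomy is
full** (`#B = (d−1)(L^d − 1)`, i.e. optimal by `TorusRankedMorseCount.isLeast_card_compl_ranked`). [ours] -/
theorem covered_determine_imp_card_eq_group (hL : 2 ≤ L) (B : Finset (Plaquette d L))
    (t : Plaquette d L → Edge d L)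
    (ht : ∀ p ∈ B, t p ∈ ({(p.1, p.2.1.1), (p.1.shift p.2.1.1, p.2.1.2),
        (p.1.shift p.2.1.2, p.2.1.1), (p.1, p.2.1.2)} : Finset (Edge d L)))
    (rank : Plaquette d L → ℕ)
    (hrank : ∀ p ∈ B, ∀ p' ∈ B, p ≠ p' → t p ∈ ({(p'.1, p'.2.1.1), (p'.1.shift p'.2.1.1, p'.2.1.2),
        (p'.1.shift p'.2.1.2, p'.2.1.1), (p'.1, p'.2.1.2)} : Finset (Edge d L)) → rank p < rank p')
    {G : Type*} [Group G] (hG : ∀ n : ℤ, n ≠ 0 → ∃ g : G, g ^ n ≠ 1)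
    (hdet : ∀ U V : GaugeConfig d L G, (∀ p ∈ B, plaquetteHolonomy U p.1 p.2.1.1 p.2.1.2 = plaquetteHolonomy V p.1 p.2.1.1 p.2.1.2) →
      ∀ p' : Plaquette d L, plaquetteHolonomy U p'.1 p'.2.1.1 p'.2.1.2 = plaquetteHolonomy V p'.1 p'.2.1.1 p'.2.1.2) :
    B.card = (d - 1) * (L ^ d - 1) := by
  by_contra hne
  have hlt : B.card < (d - 1) * (L ^ d - 1) := lt_of_le_of_ne (card_le_of_ranked hL B t ht rank hrank) hne
  obtain ⟨p', -, U, V, hcov, hp'⟩ := exists_plaquetteHolonomy_not_determined_group hL B hlt hG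
  exact hp' (hdet U V hcov p')

end Summit.Ventures.LatticeQCDFlow.Theory2.Autoregressive
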